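import Summits.QuantumFields.YangMills.Theses.SourcedPressureJensen

/-!
# Route `SourcedPressureJensen`, item `SourcedPressureIncrementGlue` (stmt-QuantumFields-23809): PROVED

WHAT.  `Summit.QuantumFields.YangMills.Theses.SourcedPressureJensen.SourcedPressureIncrementGlue`:
`ColdBoxSourcedPressure → SourcedPressureDecoupling → SourcedPressureIncrement` (KS1′ → KS2′ → KS), for the route's
rev 8/9 statements (KS1″ = FREE-cell sourced Laplace with a centring window `W` below any scale ceiling `θ₀`, KS2″ = entropic-seam decoupling with a scale ceiling
`INCR_T(h) ≤ ½·FREE_ℓ(2h; m_T) + C′β^(−κ′) + M′h²` together with `|m_T| ≤ W`).  Pointwise in `(G, r)`: KS2″ fixes the scale ceiling `θ₀`; KS1″ below it supplies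
the regime exponents `θ₀ ≥ θ > A > 0`, the rate `κ` and the Gaussian constant `σ`; KS2″ at that `(θ, A)` supplies the
centring window `W`, its own constants and, for every `(β, n, h)` in range, a cell side `ℓ + 1 ∈ [β^θ, 4β^θ]` with,
eventually in the torus size, `|m_T| ≤ W` and the comparison inequality; KS1′ at that `W` (constants `M, C, h₀, β₀`)
is applied with centring `m = m_T`, source strength `2h ≤ h₀` and every torus `L + 1 ≥ ℓ + 2` (eventually).  Chaining,
`½·(−2hσC(n)² + Cβ^(−κ) + M(2h)²) = −hσC(n)² + (C/2)β^(−κ) + 2Mh²`, and weakening `β^(−κ), β^(−κ′) ≤ β^(−min κ κ′)`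
(`β ≥ 1`) gives KS with constants `κ″ = min κ κ′`, `A`, `2M + M′`, `|C|/2 + |C′|`, `σ`, `min (h₀/2) h₁`,
`max (max β₀ β₂) 1`.  (The rev-5 proof of this file, for the periodic-box statements, became stale when the planner
restated both children in rev 6/7; the planner's kernel-checked re-proof `resplit_glue` is attached as evidence on the
items but not mounted in prover jails, so it is re-derived here.)

HONEST LABEL: this is the GLUE of the sub-route split of the deciding crux `SourcedPressureIncrement` (XL, open); it
proves no conjunct.  The route's target `WeakCouplingRates.XiPow` is a RECORD-label rung (an UPPER bound on the lattice
gap); the Yang–Mills mass gap is NOT proved by anything here.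
-/

set_option autoImplicit false

noncomputable section

open Literature.MathematicalPhysics.QuantumFieldTheory Literature.MathematicalPhysics.QuantumLattice
open Summit.QuantumFields.YangMills.Theorems.WeakCouplingRates

namespace Summit.QuantumFields.YangMills.Theorems.SourcedPressureJensen

/-- Weakening a power: for `β ≥ 1` and `κ″ ≤ κ`, `c · β^(−κ) ≤ |c| · β^(−κ″)`. [folklore] -/
theorem mul_rpow_neg_le_abs_mul_rpow_neg {β κ κ'' : ℝ} (c : ℝ) (hβ : 1 ≤ β) (hκ : κ'' ≤ κ) :
    c * β ^ (-κ) ≤ |c| * β ^ (-κ'') := by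
  have hβ0 : 0 < β := by linarith
  have h1 : β ^ (-κ) ≤ β ^ (-κ'') := Real.rpow_le_rpow_of_exponent_le hβ (by linarith)
  calc c * β ^ (-κ) ≤ |c| * β ^ (-κ) :=
        mul_le_mul_of_nonneg_right (le_abs_self c) (Real.rpow_nonneg hβ0.le _)
    _ ≤ |c| * β ^ (-κ'') := mul_le_mul_of_nonneg_left h1 (abs_nonneg c)

/-- **`SourcedPressureIncrementGlue`, PROVED** (item stmt-QuantumFields-23809 of route `SourcedPressureJensen`, rev 8/9
statements): KS1″ (`ColdBoxSourcedPressure`, free cell below a scale ceiling) → KS2″ (`SourcedPressureDecoupling`, entropic seams with a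
scale ceiling) → KS
(`SourcedPressureIncrement`), with KS's constants `κ″ = min κ κ′`, `A`, `2M + M′`, `|C|/2 + |C′|`, `σ`,
`min (h₀/2) h₁`, `max (max β₀ β₂) 1`. -/
theorem sourcedPressureIncrementGlue_proof :
    Summit.QuantumFields.YangMills.Theses.SourcedPressureJensen.SourcedPressureIncrementGlue := by
  intro h1 h2 G _ _ _ _ hG
  letI : MeasurableSpace G := borel G
  haveI : BorelSpace G := ⟨rfl⟩
  intro r
  -- KS2″ fixes the scale ceiling θ₀; KS1″ works below it; KS2″ at KS1″'s (θ, A) gives the window W; KS1″ at W gives M, C, h₀, β₀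
  obtain ⟨θ₀, hθ₀, hdec0⟩ := h2 G hG r
  obtain ⟨θ, κ, A, σ, hθ, hA, hAθ, hκ, hσ, hcell⟩ := h1 G hG r θ₀ hθ₀
  obtain ⟨W, κ', C', M', h₁, β₂, hκ', hh₁, hdec⟩ := hdec0 θ A hA hAθ hθ
  obtain ⟨M, C, h₀, β₀, hh₀, hfree⟩ := hcell W
  refine ⟨min κ κ', A, 2 * M + M', |C| / 2 + |C'|, σ, min (h₀ / 2) h₁, max (max β₀ β₂) 1, lt_min hκ hκ', hA, hσ,
    lt_min (by linarith) hh₁, ?_⟩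
  intro β hβ n hn hnA h hh hhle
  have hβ1 : 1 ≤ β := le_trans (le_max_right _ _) hβ
  have hβ₀ : β₀ ≤ β := le_trans (le_trans (le_max_left _ _) (le_max_left _ _)) hβ
  have hβ₂ : β₂ ≤ β := le_trans (le_trans (le_max_right _ _) (le_max_left _ _)) hβ
  have hh0 : 2 * h ≤ h₀ := by linarith [le_trans hhle (min_le_left _ _)]
  have hh1 : h ≤ h₁ := le_trans hhle (min_le_right _ _)
  have h2h : 0 < 2 * h := by linarith
  obtain ⟨ℓ, hℓ1, hℓ2, hev⟩ := hdec β hβ₂ n hn hnA h hh hh1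
  have hC : C / 2 * β ^ (-κ) ≤ |C| / 2 * β ^ (-min κ κ') := by
    have := mul_rpow_neg_le_abs_mul_rpow_neg C hβ1 (min_le_left κ κ')
    linarith
  have hC' : C' * β ^ (-κ') ≤ |C'| * β ^ (-min κ κ') :=
    mul_rpow_neg_le_abs_mul_rpow_neg C' hβ1 (min_le_right _ _)
  filter_upwards [hev, Filter.eventually_ge_atTop (ℓ + 1)] with L hL hLℓ
  obtain ⟨hm, hincr⟩ := hL
  -- KS1′ at centring `m_T`, source strength `2h`, cell side `ℓ`, inside the torus of side `L + 1`
  have hb := hfree β hβ₀ _ hm ℓ hℓ1 hℓ2 n hn hnA (2 * h) h2h hh0 L hLℓ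
  have hsum : (1 / 2 : ℝ) * (-(2 * h) * (σ * (curvaturePlaquetteCorr (d := 4) (by norm_num) (n : ℤ)) ^ 2) +
        C * β ^ (-κ) + M * (2 * h) ^ 2) + C' * β ^ (-κ') + M' * h ^ 2 ≤
      -h * (σ * (curvaturePlaquetteCorr (d := 4) (by norm_num) (n : ℤ)) ^ 2) + (|C| / 2 + |C'|) * β ^ (-min κ κ') +
        (2 * M + M') * h ^ 2 := by
    nlinarith [hC, hC']
  have hhalf : (1 / 2 : ℝ) * (((ℓ + 1 : ℝ) ^ 4)⁻¹ * Real.log (wilsonExpectation (L := L + 1) r.ρ β (fun U =>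
      Real.exp (-(2 * h) * (∑ x : Fin 4 → Fin (L + 1), if ((∀ k : Fin 4, ((x k : ℕ)) ≤ ℓ) ∧ ((x 1 : ℕ)) + 1 ≤ ℓ ∧
        ((x 2 : ℕ)) + 1 ≤ ℓ ∧ ((x 0 : ℕ)) + n ≤ ℓ) then toTorusObservable (L + 1) (fun V =>
          (β * plaqCost0 (d := 4) r.ρ 1 2 (configShift (fun k => -((x k : ℕ) : ℤ)) V) -
            (β * wilsonExpectation (L := L + 1) r.ρ β (toTorusObservable (L + 1) (plaqCost0 (d := 4) r.ρ 1 2)))) *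
          (β * plaqCost0 (d := 4) r.ρ 1 2 (timeShiftLG (G := G) n (configShift (fun k => -((x k : ℕ) : ℤ)) V)) -
            (β * wilsonExpectation (L := L + 1) r.ρ β (toTorusObservable (L + 1) (plaqCost0 (d := 4) r.ρ 1 2))))) U
        else 0)) *
      Real.exp (β * (∑ x : Fin 4 → Fin (L + 1), ∑ i : Fin 4, ∑ j : Fin 4, if i < j ∧ ¬ ((∀ k : Fin 4, ((x k : ℕ)) ≤ ℓ) ∧
        ((x i : ℕ)) + 1 ≤ ℓ ∧ ((x j : ℕ)) + 1 ≤ ℓ) then toTorusObservable (L + 1) (fun V =>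
          plaqCost0 (d := 4) r.ρ i j (configShift (fun k => -((x k : ℕ) : ℤ)) V)) U else 0))) /
      wilsonExpectation (L := L + 1) r.ρ β (fun U => Real.exp (β * (∑ x : Fin 4 → Fin (L + 1), ∑ i : Fin 4,
        ∑ j : Fin 4, if i < j ∧ ¬ ((∀ k : Fin 4, ((x k : ℕ)) ≤ ℓ) ∧ ((x i : ℕ)) + 1 ≤ ℓ ∧ ((x j : ℕ)) + 1 ≤ ℓ) then
          toTorusObservable (L + 1) (fun V => plaqCost0 (d := 4) r.ρ i j (configShift (fun k => -((x k : ℕ) : ℤ)) V)) U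
        else 0))))) ≤
      (1 / 2 : ℝ) * (-(2 * h) * (σ * (curvaturePlaquetteCorr (d := 4) (by norm_num) (n : ℤ)) ^ 2) +
        C * β ^ (-κ) + M * (2 * h) ^ 2) :=
    mul_le_mul_of_nonneg_left hb (by norm_num)
  linarith [hincr, hhalf, hsum]

end Summit.QuantumFields.YangMills.Theorems.SourcedPressureJensen

end
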